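import Summits.QuantumFields.BalabanUV.Beta.FP.EndJunctionSecondMoment
import Summits.QuantumFields.BalabanUV.Beta.FP.StepRecursionSymEndG

/-!
# `BalabanUV.Beta.FP.EndJunctionSecondMomentG` — road «FP», annex-G (wave 1, (R-b)): the annex `EndJunctionSecondMoment` RE-BASED ON THE GRADED (b) END — `TshotOf_JcSymLG_one ∕ _succ`,
# `d1Tel_LG_at_of_hlawLG(_of_moments)`, **`d1Tel_LG_litW_of_hlawLG_of_moments`** : pins → `hlawLG` → (J-m2)″ at the graded composite (`hJ1`, `hJ2` over `VNs ∕ WNsG`) → `D1Tel Lc (JsB12CombShSym …) Jc″`;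
# the annex's generic §1 transport lemmas (`d1Tel_of_m2Tensor_eq` …) REUSED by name; σ = {`JcSymL ↦ JcSymLG`, `VNs ↦ VNs (grading-blind)`, `WNs ↦ WNsG`, `hlawL ↦ hlawLG`}, proofs verbatim

WHY.  E-FP-73-3 = E-AN2-94-3 (road A-12, chair XCHK-E733, an2 W-16): the by-value certificate SYM2 (ii) belongs to the GRADED composite record (`tabsCompG`); the graded L chain (S-L1-G →
S-L3b-G → this file → S-END-G) is the by-value-certified tower.  `hlawLG` DISPLAY RULE ((R4), corrected attribution): (i) OPEN by name; (ii) ✓ by value OF RECORD at ONE lattice (2,3) FOR THESE GRADED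
OBJECTS (Nˢʸᵐ(G): S2 factored 1.46e−12, D₁⁺ 1.86e−12, `SPAN-SYM2.addendum4.md` 56c550e9, RULING SYM2-10; zero weight); (iii) [B12] CMP **109** (1987) p. 264 (1.20)–(1.22), printed context only.
(J-m2)″ `hJ1 hJ2` OPEN by name, untested by value (PART A of R-AN2-94-J2C not bookable; composite-only does not decide it — an2 W-16 (II)).  [folklore] bookkeeping; no `def`, no `def … : Prop`,
nothing cited, 0 sorry; the record and the L chain of record UNTOUCHED — SIBLING file.  0 estimates; 0∕4 row-D1 binders (hW ∕ hR at the locks; D1Tel ∕ D1Rep AT THE RECORD OPEN); NOT (C1),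
NOT (L2′) at the record, NOT (T-ID), NOT SDF, NOT D1, NEVER «G-an2-4 closed», NOT BetaPertH, NOT continuum, NOT Clay.

HONEST DEPENDENCY (page 1, mandatory): continuum YM on T⁴ ⇐ BetaPertH ∧ nine spine estimates (0/9 proved); BetaPertH ⇐ (D1) ∧ (D4) ∧ CAP+tail;
G-an2-4 gates asym, D1 and NE2/3/4.  HONEST FRAMING (cell contract, verbatim): «discharging `BetaPertH` makes Bałaban's UV stability UNCONDITIONAL —
a real constructive-QFT result; it is NOT the continuum limit and NOT the Clay problem.»  ABSOLUTE RULE (cell charter, verbatim): «No internally-minted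
statement may enter as a cited fact. Every hypothesis is either kernel-proved in this package or a verbatim quotation of a PUBLISHED theorem with page
reference. The manuscript(s) under audit are NOT citable for their own disputed steps — they are the thing under adjudication; programme-internal
(2001/route/tribunal) claims are never citable.»  Road «FP» OWNER, b2b-balaban-beta-d1-p3 gen 73, 2026-08-31 (σ of the annex gen 71).  No existing file touched.
-/

noncomputable section

namespace Summit.QuantumFields.BalabanUV.Beta.FP.EndJunctionSecondMomentG

open Literature.MathematicalPhysics.QuantumFieldTheory
open Literature.MathematicalPhysics.QuantumFieldTheory.Balaban1983to89
open Literature.MathematicalPhysics.QuantumFieldTheory.Balaban1983to89.Beta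
open B12Beta (secondMoment)
open DressedMomentNormalisation (dressedEntry m2Tensor)
open ScalewiseVectorSeam (readout122 readout122_m2Tensor)
open ExpKernelCalculus (hessKer)
open OneStepResolventKernel (JetData)
open OneStepKernelFamily (TshotOf TbalOf D1Tel D1Rep)
open HessianTelescopingKKT (wStep)
open Summit.QuantumFields.BalabanUV.Beta.SymSecondOrderTablesAn1 (symTablesAn1S2)
open Summit.QuantumFields.BalabanUV.Beta.SymTablesAn1S2Weighted (symTablesAn1S2w)
open Summit.QuantumFields.BalabanUV.Beta.CombChartJointEnd (JsB12CombShSym)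
open Summit.QuantumFields.BalabanUV.Beta.CombOneShotJets (JcOf TshotOf_JcOf_one)
open Summit.QuantumFields.BalabanUV.Beta.CombOneShotJetsTabs (JcOfTabs)
open Summit.QuantumFields.BalabanUV.Beta.CompositeOneShotJetData (Roots Pins)
open Summit.QuantumFields.BalabanUV.Beta.FP.CompositeOneShotJetDataSym (ANs VNs)
open Summit.QuantumFields.BalabanUV.Beta.FP.CompositeOneShotJetDataSymG (WNsG)
open Summit.QuantumFields.BalabanUV.Beta.FP.EndJunctionSecondMoment (d1Tel_of_m2Tensor_eq secondMoment_TshotOf_eq_of_m2Tensor_eq d1Rep_of_m2Tensor_eq d1Tel_and_d1Rep_of_m2Tensor_eq)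
open Summit.QuantumFields.BalabanUV.Beta.FP.TowerKernelLawNamedSym (hN_JcSym)
open Summit.QuantumFields.BalabanUV.Beta.FP.StepRecursionSymEnd (ΨL cΨL hΨdL hcΨL slotΨL cslotΨL hslotΨL hΨsL)
open Summit.QuantumFields.BalabanUV.Beta.FP.StepRecursionSymEndG (JNsLG JcSymLG hadjLG d1Tel_LG_of_hlawLG')



/-! ## §2 The L END at any junction literal `Jc'`: pins ∧ `hlawLG` ∧ (J-m2) -/

section LEndAt

variable {Lc : ℕ} [NeZero Lc] (R : Roots Lc) (P : Pins) (hLc : Odd Lc) (N : ℕ) (cΛ cB : ℝ)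

/-- [folklore] **THE L END TRANSPORTED TO ANY `Jc'`** along the junction row (J-m2) against `JcSymLG`.  `hlawLG` DISPLAY RULE (R-D1-g93-1 (R4)): (i) OPEN by name — the [K-step] law itself
is the crux; (ii) ✓ by value OF RECORD at ONE lattice (2,3), float64 (S2 factored 1.46e−12, D₁⁺ 1.86e−12; `SPAN-SYM2.addendum4.md` 56c550e9, RULING SYM2-10; informational, zero weight);
(iii) cite [B12] CMP 109 (1987) p. 264 (1.20)–(1.22), printed context only (ABSOLUTE RULE).  (J-m2) is a second DISPLAYED row, OPEN by name.  (J-m2)″ DISPLAY RULE (R-D1-g93-4 (3), extending R-D1-g93-1 (R4)): (i) OPEN by name; (ii) by value UNTESTED as stated (SYM2 (ii)'s telescoping target at (2,3) was `TshotOf Lc JcSymL 2` = the composite's own Hessian, road A-12 on Q-an2-93-J2; nearest data: Engine C's PRESTAB δ_TAB composite-vs-UNWEIGHTED-literal second-moment lines, RELAY 292∕293a — informational, zero weight on any binder); (iii) no printed cite — OUR object (the (III″) weights' second-moment job, P5c ∕ D6, #163). -/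
theorem d1Tel_LG_at_of_hlawLG (hL2 : 2 ≤ Lc) (hN2 : 2 ≤ N) (hΛ : cΛ * (Lc : ℝ) ^ 4 = 2) (hcB : cB = -((Lc : ℝ) ^ 12 / 4))
    (hlawLG : ∀ j : ℕ, 1 ≤ j → ∀ (a b : Fin 4) (z : Fin 4 → ℤ),
      hessKer (ANs R (ΨL R) j) (VNs R (ΨL R) (hΨsL R) P j) (WNsG R (ΨL R) (hΨsL R) P j) a b z =
        (Lc : ℝ) ^ 8 * dressedEntry (wStep Lc j) (TshotOf Lc (JcSymLG R P hLc N cΛ cB) j) ((Lc : ℤ) • z) a b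
          + TbalOf Lc (JsB12CombShSym hLc N (symTablesAn1S2 3 Lc cΛ) cΛ cB) j a b z)
    (Jc' : ∀ m : ℕ, JetData 3 (Lc ^ m))
    (hJ : ∀ m : ℕ, 1 ≤ m → m2Tensor (TshotOf Lc Jc' m) = m2Tensor (TshotOf Lc (JcSymLG R P hLc N cΛ cB) m)) :
    D1Tel Lc (JsB12CombShSym hLc N (symTablesAn1S2 3 Lc cΛ) cΛ cB) Jc' :=
  d1Tel_of_m2Tensor_eq _ hJ (d1Tel_LG_of_hlawLG' R P hLc N cΛ cB hL2 hN2 hΛ hcB hlawLG)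

/-- [folklore] the scale-1 one-shot kernel of the L-composite IS ROOT M‴'s step-0 kernel (anchor; an2 `TshotOf_JcOf_one` through `JcSymL 1 = JcOf … 1`, `rfl`). -/
theorem TshotOf_JcSymLG_one :
    TshotOf Lc (JcSymLG R P hLc N cΛ cB) 1 = TbalOf Lc (JsB12CombShSym hLc N (symTablesAn1S2 3 Lc cΛ) cΛ cB) 0 :=
  TshotOf_JcOf_one hLc N (fun _ => cΛ) (fun _ => cB)

/-- [folklore] the deeper one-shot kernels of the L-composite ARE the composite Hessian kernels read on the L-chart (S-L3a `hN_JcSym` fed S-L3b's theorems, read backwards). -/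
theorem TshotOf_JcSymLG_succ (j : ℕ) (hj : 1 ≤ j) :
    TshotOf Lc (JcSymLG R P hLc N cΛ cB) (j + 1) = hessKer (ANs R (ΨL R) j) (VNs R (ΨL R) (hΨsL R) P j) (WNsG R (ΨL R) (hΨsL R) P j) := by
  funext a b z
  exact (hN_JcSym hLc N cΛ cB R (ΨL R) (cΨL R) (hΨdL R) (hcΨL R) (slotΨL R) (cslotΨL R) (hslotΨL R) (JNsLG R P) (hΨsL R) (hadjLG R P)
    j hj a b z).symm

/-- [folklore] **THE L END AT ANY `Jc'`, JUNCTION ROW UNFOLDED**: (J-m2) stated against ROOT M‴'s step-0 kernel at scale 1 and against the composite Hessian kernels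
`hessKer (ANs R Ψ̂ˢ j) (VNs …) (WNs …)` at scales `j+1 ≥ 2` — S-L1's vocabulary; `hlawLG` and the two (J-m2) clauses are the ONLY hypotheses of content.  (J-m2)″ DISPLAY RULE (R-D1-g93-4 (3), extending R-D1-g93-1 (R4)): (i) OPEN by name; (ii) by value UNTESTED as stated (SYM2 (ii)'s telescoping target at (2,3) was `TshotOf Lc JcSymL 2` = the composite's own Hessian, road A-12 on Q-an2-93-J2; nearest data: Engine C's PRESTAB δ_TAB composite-vs-UNWEIGHTED-literal second-moment lines, RELAY 292∕293a — informational, zero weight on any binder); (iii) no printed cite — OUR object (the (III″) weights' second-moment job, P5c ∕ D6, #163). -/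
theorem d1Tel_LG_at_of_hlawLG_of_moments (hL2 : 2 ≤ Lc) (hN2 : 2 ≤ N) (hΛ : cΛ * (Lc : ℝ) ^ 4 = 2) (hcB : cB = -((Lc : ℝ) ^ 12 / 4))
    (hlawLG : ∀ j : ℕ, 1 ≤ j → ∀ (a b : Fin 4) (z : Fin 4 → ℤ),
      hessKer (ANs R (ΨL R) j) (VNs R (ΨL R) (hΨsL R) P j) (WNsG R (ΨL R) (hΨsL R) P j) a b z =
        (Lc : ℝ) ^ 8 * dressedEntry (wStep Lc j) (TshotOf Lc (JcSymLG R P hLc N cΛ cB) j) ((Lc : ℤ) • z) a b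
          + TbalOf Lc (JsB12CombShSym hLc N (symTablesAn1S2 3 Lc cΛ) cΛ cB) j a b z)
    (Jc' : ∀ m : ℕ, JetData 3 (Lc ^ m))
    (hJ1 : m2Tensor (TshotOf Lc Jc' 1) = m2Tensor (TbalOf Lc (JsB12CombShSym hLc N (symTablesAn1S2 3 Lc cΛ) cΛ cB) 0))
    (hJ2 : ∀ j : ℕ, 1 ≤ j → m2Tensor (TshotOf Lc Jc' (j + 1))
      = m2Tensor (hessKer (ANs R (ΨL R) j) (VNs R (ΨL R) (hΨsL R) P j) (WNsG R (ΨL R) (hΨsL R) P j))) :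
    D1Tel Lc (JsB12CombShSym hLc N (symTablesAn1S2 3 Lc cΛ) cΛ cB) Jc' := by
  refine d1Tel_LG_at_of_hlawLG R P hLc N cΛ cB hL2 hN2 hΛ hcB hlawLG Jc' (fun m hm => ?_)
  match m, hm with
  | 1, _ => rw [hJ1, TshotOf_JcSymLG_one]
  | j + 2, _ => rw [hJ2 (j + 1) (Nat.succ_pos j), TshotOf_JcSymLG_succ R P hLc N cΛ cB (j + 1) (Nat.succ_pos j)]

end LEndAt

/-! ## §3 At road «BF-x»'s (III″) one-shot literal `Jc″` — the `htel` slot F3 consumes -/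

section LitW

variable {Lc : ℕ} [NeZero Lc] (R : Roots Lc) (P : Pins) (hLc : Odd Lc) (N : ℕ) (cΛ cB : ℝ)

/-- [folklore] **THE L END FEEDS `D1BFx/RoadEndBFxLitWS.d1Rep_BFx_lit_W_sbpS`'s `htel` BINDER MODULO `hlawLG` ∧ (J-m2)″** — the junction row at the (III″) literal
`JcOfTabs hLc Nlit (fun m ↦ symTablesAn1S2w 3 (Lc^m) (cΛlit m) (wlit m)) cΛlit cBlit` (free `Nlit wlit cΛlit cBlit`, as in F3): scale 1 against the step-0 kernel, scales `j+1 ≥ 2` against the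
composite Hessian kernels on the L-chart.  (J-m2)″ is DISPLAYED, OPEN by name; its discharge = the composite-vs-literal table identification AT SECOND-MOMENT LEVEL (the (III″) weights' job);
`hlawLG` per the (R4) display rule.  Nothing of F3, ROOT M‴, P5c, D6 is touched.  (J-m2)″ DISPLAY RULE (R-D1-g93-4 (3), extending R-D1-g93-1 (R4)): (i) OPEN by name; (ii) by value UNTESTED as stated (SYM2 (ii)'s telescoping target at (2,3) was `TshotOf Lc JcSymL 2` = the composite's own Hessian, road A-12 on Q-an2-93-J2; nearest data: Engine C's PRESTAB δ_TAB composite-vs-UNWEIGHTED-literal second-moment lines, RELAY 292∕293a — informational, zero weight on any binder); (iii) no printed cite — OUR object (the (III″) weights' second-moment job, P5c ∕ D6, #163). -/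
theorem d1Tel_LG_litW_of_hlawLG_of_moments (hL2 : 2 ≤ Lc) (hN2 : 2 ≤ N) (hΛ : cΛ * (Lc : ℝ) ^ 4 = 2) (hcB : cB = -((Lc : ℝ) ^ 12 / 4))
    (hlawLG : ∀ j : ℕ, 1 ≤ j → ∀ (a b : Fin 4) (z : Fin 4 → ℤ),
      hessKer (ANs R (ΨL R) j) (VNs R (ΨL R) (hΨsL R) P j) (WNsG R (ΨL R) (hΨsL R) P j) a b z =
        (Lc : ℝ) ^ 8 * dressedEntry (wStep Lc j) (TshotOf Lc (JcSymLG R P hLc N cΛ cB) j) ((Lc : ℤ) • z) a b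
          + TbalOf Lc (JsB12CombShSym hLc N (symTablesAn1S2 3 Lc cΛ) cΛ cB) j a b z)
    (Nlit : ℕ) (wlit cΛlit cBlit : ℕ → ℝ)
    (hJ1 : m2Tensor (TshotOf Lc (JcOfTabs hLc Nlit (fun m => symTablesAn1S2w 3 (Lc ^ m) (cΛlit m) (wlit m)) cΛlit cBlit) 1)
      = m2Tensor (TbalOf Lc (JsB12CombShSym hLc N (symTablesAn1S2 3 Lc cΛ) cΛ cB) 0))
    (hJ2 : ∀ j : ℕ, 1 ≤ j → m2Tensor (TshotOf Lc (JcOfTabs hLc Nlit (fun m => symTablesAn1S2w 3 (Lc ^ m) (cΛlit m) (wlit m)) cΛlit cBlit) (j + 1))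
      = m2Tensor (hessKer (ANs R (ΨL R) j) (VNs R (ΨL R) (hΨsL R) P j) (WNsG R (ΨL R) (hΨsL R) P j))) :
    D1Tel Lc (JsB12CombShSym hLc N (symTablesAn1S2 3 Lc cΛ) cΛ cB) (JcOfTabs hLc Nlit (fun m => symTablesAn1S2w 3 (Lc ^ m) (cΛlit m) (wlit m)) cΛlit cBlit) :=
  d1Tel_LG_at_of_hlawLG_of_moments R P hLc N cΛ cB hL2 hN2 hΛ hcB hlawLG _ hJ1 hJ2

end LitW

end Summit.QuantumFields.BalabanUV.Beta.FP.EndJunctionSecondMomentG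

end
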